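import Mathlib.Algebra.Module.BigOperators
import Mathlib.Algebra.Ring.Action.Basic
import Mathlib.LinearAlgebra.Basis.VectorSpace
import Mathlib.LinearAlgebra.Finsupp.LinearCombination
import Mathlib.LinearAlgebra.LinearIndependent.Basic
import Mathlib.LinearAlgebra.Pi
import HarnessLib

/-!
# Speiser's lemma: a semilinear representation is spanned by its invariants

Let a finite group `Γ` act faithfully by ring automorphisms on a field `E`, and let `V` be an
`E`-vector space with an additive action `ρ` of `Γ` which is **semilinear**:
`ρ_s (e • v) = s(e) • ρ_s v`. Then **every vector of `V` is an `E`-linear combination of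
`Γ`-invariant vectors** (`mem_span_fixedPoints`, `span_fixedPoints_eq_top`). This is the
surjectivity half of Speiser's lemma / Galois descent for vector spaces
(`E ⊗_{E^Γ} V^Γ ≅ V`); together with the (easier) injectivity half it says that semilinear
`Γ`-spaces are the same as vector spaces over the fixed field.

## The proof (Cartier's argument in Serre, *Local Fields*, Ch. X, §1, proof of Prop. 3)

* `exists_finsupp_sum_mul_smul_eq_ite`: by Dedekind's independence of the characters
  `s : E → E` (Mathlib `linearIndependent_monoidHom`) the functions `s ↦ s(e)`, `e ∈ E`, span
  the `E`-space of all functions `Γ → E`; in particular `δ_{s,1} = ∑ᵢ cᵢ · s(eᵢ)` for finitely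
  many `cᵢ, eᵢ ∈ E`.
* For `v ∈ V` the Poincaré series `w(e) = ∑_s ρ_s (e • v) = ∑_s s(e) • ρ_s v` are invariant, and
  `∑ᵢ cᵢ • w(eᵢ) = ∑_s δ_{s,1} • ρ_s v = v`.

No finiteness of `V` or of `[E : E^Γ]` beyond the finiteness of `Γ` is needed, and the fixed
field never has to be named. Used for Hilbert's Theorem 90 for finite-dimensional algebras
(`Literature.RingTheory.GaloisAlgebras.HilbertNinetyAlgebras`, Serre, loc. cit., Exercise 2).

## References
* J.-P. Serre, *Local Fields*, GTM 67 (1979), Ch. X, §1, Prop. 3 and its proof (Speiser,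
  Cartier).
* A. Speiser, *Zahlentheoretische Sätze aus der Gruppentheorie*, Math. Z. 5 (1919), 1–6.
* N. Bourbaki, *Algebra II*, Ch. V, §10, no. 4–5.
-/

namespace Literature.RingTheory.GaloisAlgebras

open scoped BigOperators

section Dedekind

variable (Γ E : Type*) [Group Γ] [Fintype Γ] [Field E] [MulSemiringAction Γ E]
  [FaithfulSMul Γ E]

omit [Fintype Γ] in
/-- Distinct elements of a group acting faithfully by ring automorphisms on `E` give distinct
multiplicative characters `E →* E`. [folklore] -/
theorem injective_toMonoidHom_toRingHom :
    Function.Injective fun s : Γ => ((MulSemiringAction.toRingHom Γ E s : E →+* E) : E →* E) :=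
  fun _ _ hst => toRingHom_injective Γ E (RingHom.coe_monoidHom_injective hst)

/-- **Dedekind–Artin: the functions `s ↦ s(e)` span all functions `Γ → E`.** For a finite group
`Γ` acting faithfully by ring automorphisms on a field `E`, the `E`-span of the functions
`s ↦ s • e` (`e ∈ E`) is the whole space `Γ → E`: a linear form `∑_s c_s f(s)` vanishing on them
gives a linear relation `∑_s c_s s(e) = 0` among distinct characters, so `c = 0` by Dedekind's
independence theorem (Mathlib `linearIndependent_monoidHom`) (Serre, *Local Fields*, Ch. X,
§1, proof of Prop. 3). [cite: SerreLocalFields1979, Ch. X, §1, Prop. 3] -/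
theorem span_range_smul_eq_top :
    Submodule.span E (Set.range fun e : E => fun s : Γ => s • e) = ⊤ := by
  classical
  by_contra hne
  obtain ⟨f, hf0, hle⟩ :=
    Submodule.exists_le_ker_of_lt_top _ (lt_top_iff_ne_top.mpr hne)
  -- the coefficients of the linear form `f`
  set cf : Γ → E := fun s => f fun j => if s = j then 1 else 0 with hcf
  have hvan : ∀ e : E, ∑ s, (s • e) * cf s = 0 := fun e => by
    have hmem : (fun s : Γ => s • e) ∈
        Submodule.span E (Set.range fun e : E => fun s : Γ => s • e) :=
      Submodule.subset_span ⟨e, rfl⟩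
    have h0 := hle hmem
    rw [LinearMap.mem_ker, LinearMap.pi_apply_eq_sum_univ] at h0
    simpa only [smul_eq_mul] using h0
  -- Dedekind: all coefficients vanish
  have hind := (linearIndependent_monoidHom E E).comp _ (injective_toMonoidHom_toRingHom Γ E)
  have hcf0 : ∀ s, cf s = 0 := by
    refine Fintype.linearIndependent_iff.mp hind cf ?_
    ext e
    simp only [Function.comp_apply, Finset.sum_apply, Pi.smul_apply, smul_eq_mul,
      Pi.zero_apply]
    rw [← hvan e]
    refine Finset.sum_congr rfl fun s _ => ?_
    rw [mul_comm]
    rfl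
  refine hf0 (LinearMap.ext fun x => ?_)
  rw [LinearMap.pi_apply_eq_sum_univ, LinearMap.zero_apply]
  exact Finset.sum_eq_zero fun s _ => by
    rw [show f (fun j => if s = j then 1 else 0) = cf s from rfl, hcf0 s, smul_zero]

/-- **The delta function at `1` is a combination of the orbit functions**: there are finitely
many `cᵢ, eᵢ ∈ E` (packaged as a finitely supported `c : E →₀ E`, `cᵢ = c eᵢ`) with
`∑ᵢ cᵢ · s(eᵢ) = δ_{s,1}` for all `s ∈ Γ` (`span_range_smul_eq_top`; Serre, *Local Fields*,
Ch. X, §1, proof of Prop. 3). [cite: SerreLocalFields1979, Ch. X, §1, Prop. 3] -/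
theorem exists_finsupp_sum_mul_smul_eq_ite [DecidableEq Γ] :
    ∃ c : E →₀ E, ∀ s : Γ, (c.sum fun e a => a * (s • e)) = if s = 1 then 1 else 0 := by
  have hmem : (fun s : Γ => if s = 1 then (1 : E) else 0) ∈
      Submodule.span E (Set.range fun e : E => fun s : Γ => s • e) := by
    rw [span_range_smul_eq_top]
    exact Submodule.mem_top
  obtain ⟨c, hc⟩ := Finsupp.mem_span_range_iff_exists_finsupp.mp hmem
  refine ⟨c, fun s => ?_⟩
  have := congr_fun hc s
  simpa only [Finsupp.sum, Finset.sum_apply, Pi.smul_apply, smul_eq_mul] using this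

end Dedekind

section Speiser

variable {Γ E V : Type*} [Group Γ] [Fintype Γ] [Field E] [MulSemiringAction Γ E]
  [FaithfulSMul Γ E] [AddCommGroup V] [Module E V]

/-- **Speiser's lemma (surjectivity half): a semilinear representation is spanned by its
invariant vectors.** Let the finite group `Γ` act faithfully by ring automorphisms on the field
`E` and additively on the `E`-vector space `V` through `ρ`, semilinearly:
`ρ_s (e • v) = s(e) • ρ_s v`. Then every `v ∈ V` is an `E`-linear combination of `ρ`-invariant
vectors: with `∑ᵢ cᵢ s(eᵢ) = δ_{s,1}` (`exists_finsupp_sum_mul_smul_eq_ite`) and the invariant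
Poincaré series `w(e) = ∑_s ρ_s(e • v)`, `v = ∑ᵢ cᵢ • w(eᵢ)` (Cartier's argument, Serre,
*Local Fields*, Ch. X, §1, proof of Prop. 3; Speiser 1919). [cite: SerreLocalFields1979, Ch. X, §1, Prop. 3] -/
theorem mem_span_fixedPoints (ρ : Γ →* AddMonoid.End V)
    (hρ : ∀ (s : Γ) (e : E) (v : V), ρ s (e • v) = (s • e) • ρ s v) (v : V) :
    v ∈ Submodule.span E {w : V | ∀ s : Γ, ρ s w = w} := by
  classical
  obtain ⟨c, hc⟩ := exists_finsupp_sum_mul_smul_eq_ite Γ E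
  -- the invariant Poincaré series attached to `v`
  let w : E → V := fun e => ∑ s, ρ s (e • v)
  have hw : ∀ e t, ρ t (w e) = w e := fun e t => by
    simp only [w, map_sum]
    calc ∑ s, ρ t (ρ s (e • v)) = ∑ s, ρ (t * s) (e • v) :=
          Finset.sum_congr rfl fun s _ => by rw [map_mul]; rfl
      _ = ∑ s, ρ s (e • v) :=
          Fintype.sum_equiv (Equiv.mulLeft t) _ _ fun s => rfl
  have hv : (c.sum fun e a => a • w e) = v := by
    simp only [w, hρ, Finset.smul_sum, smul_smul]
    rw [Finsupp.sum, Finset.sum_comm]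
    simp_rw [← Finset.sum_smul]
    have hc' : ∀ s : Γ, ∑ e ∈ c.support, c e * (s • e) = if s = 1 then 1 else 0 := fun s => hc s
    simp_rw [hc', ite_smul, one_smul, zero_smul, Finset.sum_ite_eq', Finset.mem_univ, if_true,
      map_one]
    rfl
  rw [← hv]
  exact Submodule.sum_mem _ fun e _ =>
    Submodule.smul_mem _ _ (Submodule.subset_span fun s => hw e s)

/-- **Speiser's lemma, span form**: the `E`-span of the invariant vectors of a semilinear
representation of a finite group acting faithfully on `E` is everything
(`mem_span_fixedPoints`). [cite: SerreLocalFields1979, Ch. X, §1, Prop. 3] -/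
theorem span_fixedPoints_eq_top (ρ : Γ →* AddMonoid.End V)
    (hρ : ∀ (s : Γ) (e : E) (v : V), ρ s (e • v) = (s • e) • ρ s v) :
    Submodule.span E {w : V | ∀ s : Γ, ρ s w = w} = ⊤ :=
  Submodule.eq_top_iff'.mpr fun v => mem_span_fixedPoints ρ hρ v

/-- **Speiser's lemma for a semilinear `DistribMulAction`**: if `Γ` also acts on `V` by a
distributive action with `s • (e • v) = (s • e) • (s • v)`, every vector is an `E`-combination
of `Γ`-fixed vectors (`mem_span_fixedPoints` for `DistribMulAction.toAddMonoidEnd`).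
[cite: SerreLocalFields1979, Ch. X, §1, Prop. 3] -/
theorem mem_span_fixedPoints_smul [DistribMulAction Γ V]
    (h : ∀ (s : Γ) (e : E) (v : V), s • (e • v) = (s • e) • s • v) (v : V) :
    v ∈ Submodule.span E (MulAction.fixedPoints Γ V) := by
  have hset : {w : V | ∀ s : Γ, DistribMulAction.toAddMonoidEnd Γ V s w = w} =
      MulAction.fixedPoints Γ V := by
    ext w
    simp only [Set.mem_setOf_eq, MulAction.mem_fixedPoints]
    rfl
  rw [← hset]
  exact mem_span_fixedPoints (E := E) (DistribMulAction.toAddMonoidEnd Γ V) h v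

end Speiser

end Literature.RingTheory.GaloisAlgebras
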